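import Summits.ResolutionOfSingularities.ResolutionOfSingularities.Theorems.StallVertexCompanion8
import HarnessLib

/-! ## Landing note (decomp-res writer g12)

Content VERBATIM from the decomp-res lens-5 g30 landing file
`HOME/decomp-res-lens-5/g30/landing/StallVertexDrift.lean` (pin 61237ca2, 432 l;
HOME = run/shared/lean/pub/decomp-res; = the NEW part of the g30 node `StallVertexDrift.lean` a84b1cdc, whose carry
of generation 29 is the landed
`Theorems/StallVertexCompanion` … `StallVertexCompanion8`).  Critic: CRITIC-LEDGER row 195 (0-weight TOOLS: the
drift layer D1/D2/D1♭/D2♭, the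
drift law T3, drift i.o. T4; no new cells, node equation = generation 29's); landing orders = the critic rider INBOX
:1156 (b): first import
re-pointed at the LAST landed part `Theorems.StallVertexCompanion8` (the file's own placeholder comment removed),
split after `end AlgebraDrift`
for the 400-line cap — THIS is part 1/2 (`section AlgebraDrift`, §1m); part 2/2 `StallVertexDrift2` carries `section
WalkDrift` (§2g) and
`section LeafDrift` (§3e).  `--kind proof --supports stmt-ResolutionOfSingularities-31770`; no aside switch;
namespace `…Theorems.StallVertex`;
farm (writer, both parts against the landed tree): rc 0 · 0 err · 0 sorry. -/

/-!
# StallVertexDrift — decomp-res lens-5, generation 30 (rev 11 of the node «StallVertex»)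

THE DRIFT LAW ON THE TANGENT LEAF, in kernel: on Kawanoue–Matsuki's companion the INTERFERENCE of a move (the unclean
tail layer, `StallVertexClean` / `StallVertexEcho`) IS the DRIFT of its osculating plane.  Target of the generation
(critic row 192): the located residual `NoTangentPositiveSkewStalledTailsDeep` of the host item
`MaxContactCut.DefectWalksDeep` (`defectWalksDeep_iff_tangentPositive_nullFlat`, generation 29).

HONEST SCORE.  The window's (S-3) item — use the drift law to EMPTY the NON-RESONANT kind (`p ∤ w`) — is NOT
delivered: the non-resonant kind is exactly Kawanoue–Matsuki's `e₂ = 0` case (a classical smooth hypersurface of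
maximal contact EXISTS for the companion), whose emptiness is the dimension-3 idealistic-filtration theorem on the
CURVED maximal contact hypersurface (arXiv:1205.4556, Thm. for `dim W = 3`; restriction to a hypersurface + power
series) — a PORT, not a kernel law, in the `MvPolynomial` model; and the letter + drift system of the leaf is
CONSISTENT (period-5 table in NODE-g30.md §2), so no law at letter / first-layer level closes it.  What IS delivered
are the kernel TOOLS below (D1/D2 all `p`, all `w`; D1♭/D2♭ the resonance criterion; T3/T4 on the walk), 0 sorry,
standard axioms.  No new cells are cut (a resonance lettering without the non-resonant side emptied is not a cut — row
192); the node equation stays generation 29's.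

LANDING SHAPE (this file): the generation-29 node is IMPORTED (`Theorems.StallVertexCompanion*`), nothing is
carried; pure addition, `--kind proof --supports stmt-ResolutionOfSingularities-31770`.

NEW IN THIS FILE:

§1m THE DRIFT LAYER OF A TANGENT CONE (letters `σ`, any field; continues §1l A2 `low_layer_of_cone`).  In the
two-layer situation `u_j^E (A + u_j B) = r' u^{S'' + E·1_j} H'^w` (`A`, `S''` free of `u_j`; `H' = Σ c'_i u_i` the
plane, `H'♭ = H'(u_j ↦ 0)` the CARRIED plane, `γ = c'_j` the DRIFT): D1 `drift_layer`: `u_j B = r' u^{S''} (H'^w −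
(H'♭)^w)` — the high layer is forced by the plane; D2 `high_layer_eq_zero_iff` (`r' ≠ 0`, `w ≥ 1`): `B = 0 ⟺ γ = 0` —
for EVERY `p` and EVERY `w` (evaluate at `e_j`); D1♭ `first_drift_layer`: `B = w γ r' u^{S''} (H'♭)^{w−1} + u_j R`;
D2♭ `first_drift_layer_eq_zero_iff` (`r' ≠ 0`, `H'♭ ≠ 0`): that first layer vanishes ⟺ `(w : K) = 0 ∨ γ = 0`.

§2g THE DRIFT LAW (walk level; `TangentDatum` = the body of `TangentAt`).  T3 `drift_law`: on a positive skew stalled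
tail at a move `t ≥ N` with minimiser `J₀` (vertex order `n = m + 1`), for ANY tangent datum `(r', c', w)` at `t + 1`:
`u_j · in_m(tailForm) = r' u^{B(t+1)∖j} (H'^w − (H'♭)^w)`;  `CleanMove ⟺ c'_j = 0` (CLEAN ⟺ CARRIED: the unclean layer
of `StallVertexEcho.resonance` is the drift's difference quotient, never free data); `in_m(tailForm) = w c'_j r'
u^{B(t+1)∖j} (H'♭)^{w−1} + u_j R`;  first layer `= 0 ⟺ p ∣ w ∨ c'_j = 0` — RESONANCE: for `p ∤ w` (Kawanoue–Matsuki
`e₂ = 0`, a classical hypersurface of maximal contact) the drift is visible in the first tail layer, for `p ∣ w` (`e₂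
= v_p(w) ≥ 1`, the wild case) it hides up to the layer `u_j^{p^{e₂}−1}`.

§3e T4 `drift_io`: on the binders of the tangent leaf, for every `M` some move `t ≥ M, N` has a minimiser whose every
tangent datum at `t + 1` DRIFTS (`c'_{j_t} ≠ 0`) — `unclean_io_of_muTilde_pos` + D2: the osculating plane is
translated infinitely often (Kawanoue–Matsuki's «Moreover `c ≠ 0`», Prop. 4 (1), as a theorem about the forced walk);
«eventually carried ⟹ `ContactLineFrom`» never fires on the residual.

PROVED, 0 sorry, no `allowUnsafeReducibility`.  Imports the landed `StallVertexLockClasses`, `PlanarGhostDescent`.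
-/

noncomputable section

open MvPolynomial Finset
open Literature.AlgebraicGeometry.Resolution
open Literature.AlgebraicGeometry.Resolution.Hauser2010
open Literature.AlgebraicGeometry.Resolution.HauserPerlega2024
open Literature.Barriers.ResolutionOfSingularities
open Literature.AlgebraicGeometry.Resolution.PointBlowup
open Summit.ResolutionOfSingularities.ResolutionOfSingularities.Theses
open Summit.ResolutionOfSingularities.ResolutionOfSingularities.Theorems.TightDefectClasses
open Summit.ResolutionOfSingularities.ResolutionOfSingularities.Theorems.ProximityCut
open Summit.ResolutionOfSingularities.ResolutionOfSingularities.Theorems.ExitLaw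
open Summit.ResolutionOfSingularities.ResolutionOfSingularities.Theorems.DifferentialShade

namespace Summit.ResolutionOfSingularities.ResolutionOfSingularities.Theorems.StallVertex


section AlgebraDrift

/-! ### §1m (rev 11, generation 30) THE DRIFT LAYER OF A TANGENT CONE: the interfering layer is forced by the plane -/

variable {σ : Type*} {K : Type*} [Field K] [Fintype σ] [DecidableEq σ] [DecidableEq K]

omit [Fintype σ] [DecidableEq σ] [DecidableEq K] in
/-- `(P + u_j Q)^(n+1) = P^(n+1) + u_j · (n+1) P^n Q + u_j² · R`: the binomial expansion to second order in `u_j`.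
[folklore] -/
theorem add_X_mul_pow_succ (j : σ) (P Q : MvPolynomial σ K) (n : ℕ) :
    ∃ R : MvPolynomial σ K, (P + X j * Q) ^ (n + 1) =
      P ^ (n + 1) + X j * (((n + 1 : ℕ) : MvPolynomial σ K) * P ^ n * Q) + X j ^ 2 * R := by
  induction n with
  | zero => exact ⟨0, by push_cast; ring⟩
  | succ n ih =>
    obtain ⟨R, hR⟩ := ih
    exact ⟨R * (P + X j * Q) + ((n + 1 : ℕ) : MvPolynomial σ K) * P ^ n * Q * Q, by
      rw [pow_succ, hR]; push_cast; ring⟩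

omit [DecidableEq σ] [DecidableEq K] in
/-- Evaluation of a linear form. [folklore] -/
theorem eval_linear (x : σ → K) (c : σ → K) : eval x (∑ i, C (c i) * X i) = ∑ i, c i * x i := by
  rw [map_sum]
  refine Finset.sum_congr rfl fun i _ => ?_
  rw [map_mul, eval_C, eval_X]

omit [DecidableEq K] in
/-- A linear form evaluated at the `j`-th unit vector is its `u_j`-coefficient. [folklore] -/
theorem eval_linear_single (j : σ) (c : σ → K) : eval (Pi.single j 1) (∑ i, C (c i) * X i) = c j := by
  rw [eval_linear, Finset.sum_eq_single j (fun i _ hij => by rw [Pi.single_eq_of_ne hij, mul_zero])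
    (fun h => absurd (Finset.mem_univ j) h), Pi.single_eq_same, mul_one]

omit [DecidableEq K] in
/-- **D1 — THE DRIFT LAYER (the high layer of a tangent cone).**  In the situation of A2 — the two-layer form
`u_j^E (A + u_j B)` (`A` free of `u_j`) equals the cone `r' · u^{S'' + E·1_j} · H'^w` (`S''` free of `u_j`) — the HIGH
layer is forced as well: `u_j · B = r' u^{S''} · (H'^w − (H'♭)^w)` with `H'♭ = H'(u_j ↦ 0)` the carried plane.  Read on
the walk (`drift_law`): the first interfering layer `in_{n−1}(tailForm)` of a move on the tangent leaf is NOT free data —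
it is the binomial difference quotient of the DRIFT `γ = H'_j` of the tangent plane. [new] [folklore] -/
theorem drift_layer (j : σ) (E : ℕ) {A : MvPolynomial σ K} (B : MvPolynomial σ K)
    (hA : ∀ e ∈ A.support, e j = 0) (S'' : σ →₀ ℕ) (hS : S'' j = 0) (r' : K) (c' : σ → K) (w : ℕ)
    (h : X j ^ E * (A + X j * B) = monomial (S'' + Finsupp.single j E) r' * (∑ i, C (c' i) * X i) ^ w) :
    X j * B = monomial S'' r' *
      ((∑ i, C (c' i) * X i) ^ w - (∑ i, C (Function.update c' j 0 i) * X i) ^ w) := by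
  have hA2 := low_layer_of_cone j E B hA S'' hS r' c' w h
  have hmono : (monomial (S'' + Finsupp.single j E) r' : MvPolynomial σ K) = X j ^ E * monomial S'' r' := by
    rw [X_pow_eq_monomial, monomial_mul, one_mul, add_comm]
  have hXE : (X j : MvPolynomial σ K) ^ E ≠ 0 := pow_ne_zero E (X_ne_zero j)
  have h1 : A + X j * B = monomial S'' r' * (∑ i, C (c' i) * X i) ^ w := by
    apply mul_left_cancel₀ hXE
    rw [h, hmono, mul_assoc]
  rw [hA2] at h1
  linear_combination h1

omit [DecidableEq K] in
/-- **D2 — CLEAN ⟺ CARRIED.**  In the situation of D1 with `r' ≠ 0`, `w ≥ 1`: the high layer `B` VANISHES iff the plane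
`H'` has no `u_j`-component (`H'_j = 0`: the plane at the new point is the CARRIED plane `H'♭`) — in EVERY characteristic
and for EVERY `w` (evaluate `H'^w = (H'♭)^w` at the `j`-th unit vector).  On the walk: a move on the tangent leaf is
`CleanMove` iff the tangent plane does not drift (`drift_law`). [new] [folklore] -/
theorem high_layer_eq_zero_iff (j : σ) (E : ℕ) {A : MvPolynomial σ K} (B : MvPolynomial σ K)
    (hA : ∀ e ∈ A.support, e j = 0) (S'' : σ →₀ ℕ) (hS : S'' j = 0) {r' : K} (hr' : r' ≠ 0) (c' : σ → K)
    {w : ℕ} (hw : 0 < w)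
    (h : X j ^ E * (A + X j * B) = monomial (S'' + Finsupp.single j E) r' * (∑ i, C (c' i) * X i) ^ w) :
    B = 0 ↔ c' j = 0 := by
  have hD := drift_layer j E B hA S'' hS r' c' w h
  constructor
  · intro hB
    rw [hB, mul_zero, eq_comm, mul_eq_zero, monomial_eq_zero, sub_eq_zero] at hD
    have hev := congrArg (eval (Pi.single j (1 : K))) (hD.resolve_left hr')
    rw [map_pow, map_pow, eval_linear_single, eval_linear_single, Function.update_self, zero_pow hw.ne'] at hev
    exact (pow_eq_zero_iff hw.ne').mp hev
  · intro hc
    have hup : Function.update c' j 0 = c' := by rw [← hc]; exact Function.update_eq_self j c'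
    rw [hup, sub_self, mul_zero, mul_eq_zero] at hD
    exact hD.resolve_left (X_ne_zero j)

omit [DecidableEq K] in
/-- **D1♭ — THE FIRST DRIFT LAYER.**  In the situation of D1 with `w = m + 1`: modulo `u_j` the high layer is
`w · γ · r' u^{S''} · (H'♭)^{w−1}`, `γ = H'_j` the drift: `B = w γ · r' u^{S''} (H'♭)^{w−1} + u_j · R`. [new] [folklore] -/
theorem first_drift_layer (j : σ) (E : ℕ) {A : MvPolynomial σ K} (B : MvPolynomial σ K)
    (hA : ∀ e ∈ A.support, e j = 0) (S'' : σ →₀ ℕ) (hS : S'' j = 0) (r' : K) (c' : σ → K) (m : ℕ)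
    (h : X j ^ E * (A + X j * B) = monomial (S'' + Finsupp.single j E) r' * (∑ i, C (c' i) * X i) ^ (m + 1)) :
    ∃ R : MvPolynomial σ K, B = ((m + 1 : ℕ) : MvPolynomial σ K) * C (c' j) * monomial S'' r' *
      (∑ i, C (Function.update c' j 0 i) * X i) ^ m + X j * R := by
  have hD := drift_layer j E B hA S'' hS r' c' (m + 1) h
  obtain ⟨H, hH⟩ : ∃ H : MvPolynomial σ K, H = ∑ i, C (c' i) * X i := ⟨_, rfl⟩
  obtain ⟨Hf, hHf⟩ : ∃ Hf : MvPolynomial σ K, Hf = ∑ i, C (Function.update c' j 0 i) * X i := ⟨_, rfl⟩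
  rw [← hH, ← hHf] at hD
  rw [← hHf]
  have hsplit : H = Hf + X j * C (c' j) := by
    rw [hH, hHf, show (∑ i, C (Function.update c' j 0 i) * X i : MvPolynomial σ K) =
        ∑ i, (C (c' i) * X i - if i = j then C (c' j) * X j else 0) from Finset.sum_congr rfl fun i _ => by
          by_cases hij : i = j
          · subst hij; rw [if_pos rfl, Function.update_self, C_0, zero_mul, sub_self]
          · rw [if_neg hij, Function.update_of_ne hij, sub_zero],
      Finset.sum_sub_distrib, Finset.sum_ite_eq', if_pos (Finset.mem_univ _), mul_comm (X j), sub_add_cancel]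
  obtain ⟨R, hR⟩ := add_X_mul_pow_succ j Hf (C (c' j)) m
  refine ⟨monomial S'' r' * R, ?_⟩
  apply mul_left_cancel₀ (X_ne_zero j : (X j : MvPolynomial σ K) ≠ 0)
  rw [hD, hsplit, hR]
  ring

omit [DecidableEq K] in
/-- **D2♭ — RESONANCE.**  The first drift layer `w γ · r' u^{S''} (H'♭)^{m}` (D1♭; `r' ≠ 0`, `H'♭ ≠ 0`) VANISHES iff
`w = 0` in `K` or the plane is carried (`γ = 0`): for a DRIFTING plane the interference is visible in the first layer
of the tail EXACTLY WHEN `p ∤ w` — NON-RESONANT, Kawanoue–Matsuki's second exponent `e₂ = 0` (the companion has a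
Hasse derivative of order `w − 1` with a non-zero LINEAR initial form: a classical hypersurface of maximal contact
exists); for `p ∣ w` — RESONANT, `e₂ = v_p(w) ≥ 1` — the drift first shows in the layer `u_j^{p^{e₂}−1}` of the tail
(the wild case of arXiv:1205.4556, Proposition 4 (1) «Moreover»). [new] [folklore] -/
theorem first_drift_layer_eq_zero_iff (j : σ) (S'' : σ →₀ ℕ) {r' : K} (hr' : r' ≠ 0) (c' : σ → K)
    (hl : ∃ i, Function.update c' j 0 i ≠ 0) (w m : ℕ) :
    (w : MvPolynomial σ K) * C (c' j) * monomial S'' r' * (∑ i, C (Function.update c' j 0 i) * X i) ^ m = 0 ↔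
      (w : K) = 0 ∨ c' j = 0 := by
  have hHf : (∑ i, C (Function.update c' j 0 i) * X i : MvPolynomial σ K) ^ m ≠ 0 :=
    pow_ne_zero _ (linear_ne_zero _ hl)
  have hmono : (monomial S'' r' : MvPolynomial σ K) ≠ 0 := by rw [Ne, monomial_eq_zero]; exact hr'
  rw [← map_natCast (C : K →+* MvPolynomial σ K) w, mul_eq_zero, mul_eq_zero, mul_eq_zero, C_eq_zero, C_eq_zero]
  tauto

end AlgebraDrift

end Summit.ResolutionOfSingularities.ResolutionOfSingularities.Theorems.StallVertex
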